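import Mathlib
import HarnessLib
import Literature.Analysis.FluidPDE.TypeIAncientMild
import Literature.Analysis.FluidPDE.ClassicalSolutionRescale
import Literature.Analysis.FluidPDE.StretchingRate
import Summits.NavierStokesRegularity.NavierStokesRegularity.Theorems.IsobarTomographyBlobRiccatiClosureStubPeakGrowth
import Summits.NavierStokesRegularity.NavierStokesRegularity.Theorems.IsobarTomographyTubeAlternativeStubPeakZoomPatchLineLimit

/-!
# Crux `IsobarTomography.BlobRiccatiClosure` (stmt-NavierStokesRegularity-11740), line
# `type-i-apex-liouville` — structure at an apex: stretching at least at the self-similar rate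

Helper file (theorems only) `--supports` the item: the first structural consequence of the APEX
normalisation produced by stub B (`stub_apexZoom`) and consumed by the residual C
(`stub_apexAntiBlob`). If `(σ, 0)`, `σ < 0`, is an apex of a field `W` with a classical pressure on
`(−∞, 0)` — `‖curl W(σ, 0)‖ = 1` and `(−s)‖curl W(s, y)‖ ≤ −σ` for all `s < 0`, `y` — then the
vortex-stretching rate at the apex is at least the self-similar rate:

  `1/(−σ) ≤ α(W(σ))(0)`,  `α = ⟪ξ, ∇W ξ⟫` (`stretchingRate`).

Proof (registered sub-goal `stub_apexStretching`). Time: `f(s) = ‖curl W(s, 0)‖²` satisfies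
`f(s) ≤ σ²/s²` for `s < 0` with equality at `σ`, so `s ↦ f(s) − σ²/s²` has a local maximum at `σ`
and `f′(σ) = 2/(−σ)` (Danskin's condition for the two-sided extremum in time). Space: `y ↦ f(σ, y)`
is globally maximal at `0`, so the landed enstrophy-density inequality at a vorticity maximum
(`Sketch.stub_peakGrowth`: `∂ₜ‖ω‖² ≤ 2‖ω‖²α` — the diffusion term is `≤ 0` at the maximum, the
transport term vanishes), applied to the time-translate of `(W, q)` onto a window `[0, −σ)`
(`IsClassicalNSSolutionOn.stRescale` with unit weights), gives `f′(σ) ≤ 2α`. Hence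
`α ≥ 1/(−σ) > 0`: an apex is being stretched, at least at the self-similar rate — the identity-level
signature of apexes recorded in the crux's STRATEGY-CENSUS (§Decomposition (a)), now a theorem.
No Type-I hypothesis is needed for this step; it is stated for any classical pair on `(−∞, 0)`.

References: A. Majda, A. Bertozzi, *Vorticity and Incompressible Flow* (2002), §5.1 (5.8)–(5.9)
[MajdaBertozziCUP2002]; folklore (first-order conditions at extrema).
-/

noncomputable section

open Set Filter Topology Function
open scoped RealInnerProductSpace

-- the summit and its single sub-problem share the name (CONVENTIONS §1), as in every Theorems file
set_option linter.dupNamespace false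

namespace Summit.NavierStokesRegularity.NavierStokesRegularity.Theorems.BlobRiccatiClosure.TypeIApexLiouville

open Literature.Analysis Literature.Analysis.FluidPDE
open Summit.NavierStokesRegularity.NavierStokesRegularity.Theorems
open Summit.NavierStokesRegularity.NavierStokesRegularity.Theorems.TubeAlternative.AnalyticPropagation
  (isSmoothSpaceTimeOn_curl)

/-- **Danskin in time at an apex.** If `f : ℝ → ℝ` is differentiable at `σ < 0`, `f ≤ σ²/s²` near
`σ` and `f(σ) = 1`, then `f′(σ) = 2/(−σ)` (the function `f − σ²/s²` has a local maximum at `σ`).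
[folklore] -/
theorem deriv_eq_of_le_sq_div_sq {f : ℝ → ℝ} {σ : ℝ} (hσ : σ < 0) (hf : DifferentiableAt ℝ f σ)
    (hle : ∀ᶠ s in 𝓝 σ, f s ≤ σ ^ 2 / s ^ 2) (h1 : f σ = 1) : deriv f σ = 2 / (-σ) := by
  have hσ0 : σ ≠ 0 := hσ.ne
  -- the comparison function and its derivative at `σ`
  have hq : HasDerivAt (fun s : ℝ => σ ^ 2 / s ^ 2) (-(2 / σ)) σ := by
    have h1 : HasDerivAt (fun s : ℝ => s ^ 2) (2 * σ) σ := by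
      simpa using hasDerivAt_pow 2 σ
    have h2 := (h1.inv (pow_ne_zero 2 hσ0)).const_mul (σ ^ 2)
    have h3 : σ ^ 2 * (-(2 * σ) / (σ ^ 2) ^ 2) = -(2 / σ) := by
      field_simp
    rw [h3] at h2
    refine h2.congr_of_eventuallyEq (Eventually.of_forall fun s => ?_)
    simp [div_eq_mul_inv]
  have hmax : IsLocalMax (fun s => f s - σ ^ 2 / s ^ 2) σ := by
    filter_upwards [hle] with s hs
    have hσσ : σ ^ 2 / σ ^ 2 = 1 := div_self (pow_ne_zero 2 hσ0)
    rw [hσσ, h1]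
    linarith
  have h0 : deriv (fun s => f s - σ ^ 2 / s ^ 2) σ = 0 := hmax.deriv_eq_zero
  have hsub : deriv (fun s => f s - σ ^ 2 / s ^ 2) σ = deriv f σ - (-(2 / σ)) := by
    rw [← hq.deriv]
    exact deriv_sub hf hq.differentiableAt
  rw [hsub] at h0
  have : deriv f σ = -(2 / σ) := by linarith
  rw [this, div_neg]

/-- **Registered sub-goal `stub_apexStretching`: at an apex the vortex is stretched at least at the
self-similar rate.** For a classical pair `(W, q)` on `(−∞, 0)` (unit viscosity, no force) and an
apex `(σ, 0)` — `‖curl W(σ, 0)‖ = 1`, `(−s)‖curl W(s, y)‖ ≤ −σ` for all `s < 0`, `y` — the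
stretching rate satisfies `1/(−σ) ≤ α(W(σ))(0)`. [cite: MajdaBertozziCUP2002, §5.1 (5.8)–(5.9)] -/
theorem stub_apexStretching : ∀ (W : ℝ → EuclideanSpace ℝ (Fin 3) → EuclideanSpace ℝ (Fin 3)) (q : ℝ → EuclideanSpace ℝ (Fin 3) → ℝ) (σ : ℝ), IsClassicalNSSolutionOn (Iio 0) 1 0 W q → σ < 0 → ‖curl (W σ) 0‖ = 1 → (∀ s < 0, ∀ y : EuclideanSpace ℝ (Fin 3), (-s) * ‖curl (W s) y‖ ≤ -σ) → 1 / (-σ) ≤ stretchingRate (W σ) 0 := by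
  intro W q σ hWq hσ hω1 hapex
  set G : ℝ := -σ with hG
  have hG0 : 0 < G := neg_pos.2 hσ
  -- ## (1) Danskin in time: `f′(σ) = 2/G` for `f(s) = ‖curl W(s, 0)‖²`
  set f : ℝ → ℝ := fun s => ‖curl (W s) 0‖ ^ 2 with hf
  have hcurl := isSmoothSpaceTimeOn_curl hWq.smooth_velocity isOpen_Iio
  have hfd : DifferentiableAt ℝ f σ :=
    ((hcurl.hasDerivAt_timeLine isOpen_Iio hσ 0).differentiableAt).norm_sq ℝ
  have hle : ∀ᶠ s in 𝓝 σ, f s ≤ σ ^ 2 / s ^ 2 := by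
    filter_upwards [isOpen_Iio.mem_nhds hσ] with s hs
    have hs0 : 0 < -s := neg_pos.2 hs
    have h1 : ‖curl (W s) 0‖ ≤ G / (-s) := by
      rw [le_div_iff₀ hs0, mul_comm]; exact hapex s hs 0
    have h2 : ‖curl (W s) 0‖ ^ 2 ≤ (G / (-s)) ^ 2 := pow_le_pow_left₀ (norm_nonneg _) h1 2
    calc f s = ‖curl (W s) 0‖ ^ 2 := rfl
      _ ≤ (G / (-s)) ^ 2 := h2
      _ = σ ^ 2 / s ^ 2 := by rw [hG, div_pow, neg_sq, neg_sq]
  have hf1 : f σ = 1 := by simp only [hf, hω1, one_pow]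
  have hf' : deriv f σ = 2 / G := deriv_eq_of_le_sq_div_sq hσ hfd hle hf1
  -- ## (2) the time-translate onto the window `[0, G)` and peak growth at the apex
  set t₀ : ℝ := σ - G / 2 with ht₀
  set u : ℝ → EuclideanSpace ℝ (Fin 3) → EuclideanSpace ℝ (Fin 3) :=
    (1 : ℝ) • stPull 1 1 t₀ 0 W with hu
  set qu : ℝ → EuclideanSpace ℝ (Fin 3) → ℝ := (1 : ℝ) ^ 2 • stPull 1 1 t₀ 0 q with hqu
  have hcl : IsClassicalNSSolutionOn (Ico 0 G) 1 0 u qu := by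
    have key := hWq.stRescale one_pos one_pos (show (1 : ℝ) = 1 * 1 by norm_num) t₀ 0
    have hforce : ((1 : ℝ) ^ 2 * 1) • stPull 1 1 t₀ (0 : EuclideanSpace ℝ (Fin 3))
        (0 : ℝ → EuclideanSpace ℝ (Fin 3) → EuclideanSpace ℝ (Fin 3)) = 0 := by
      funext s y; simp [stPull]
    rw [show (1 : ℝ) * 1 / 1 = 1 by norm_num, hforce] at key
    refine key.mono (fun r hr => ?_) (uniqueDiffOn_Ico 0 G)
    show t₀ + 1 * r ∈ Iio 0
    simp only [mem_Iio, ht₀, one_mul]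
    linarith [hr.2]
  have hu_apply : ∀ s y, u s y = W (t₀ + s) y := by
    intro s y
    simp [hu]
  have huslice : ∀ s, u s = W (t₀ + s) := fun s => funext (hu_apply s)
  have hσeq : t₀ + G / 2 = σ := by simp only [ht₀]; ring
  have huσ : u (G / 2) = W σ := by rw [huslice, hσeq]
  have hmaxOn : IsMaxOn (fun y => ‖curl (u (G / 2)) y‖ ^ 2) univ 0 := by
    intro y _
    simp only [huσ, hω1, one_pow]
    have h1 : ‖curl (W σ) y‖ ≤ 1 := by
      have h := hapex σ hσ y
      rw [← hG] at h
      nlinarith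
    exact (sq_le_one_iff₀ (norm_nonneg _)).2 h1
  have hGI : G / 2 ∈ Ico 0 G := ⟨by linarith, by linarith⟩
  have hpg := Sketch.stub_peakGrowth 1 G u qu zero_le_one hG0 hcl (G / 2) hGI 0 hmaxOn
  -- the left side is `f′(σ)`
  have hL : timeDerivWithin (Ico 0 G) (fun s y => ‖curl (u s) y‖ ^ 2) (G / 2) 0 = deriv f σ := by
    rw [timeDerivWithin, derivWithin_of_mem_nhds (Ico_mem_nhds (by linarith : (0 : ℝ) < G / 2) hGI.2)]
    have hfun : (fun s => ‖curl (u s) 0‖ ^ 2) = fun s => f (t₀ + s) := by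
      funext s; simp only [hf, huslice]
    rw [hfun, deriv_comp_const_add, hσeq]
  -- the right side is `2α` at the apex
  rw [hL, hf', huσ, hω1, one_pow, one_mul] at hpg
  have : 1 / G ≤ stretchingRate (W σ) 0 := by
    rw [div_le_iff₀ hG0] at hpg ⊢
    linarith
  simpa only [hG] using this

/-- **The sharp apex law: stretching controls the self-similar rate AND the vorticity gradient.**
At an apex `(σ, 0)` of a classical pair `(W, q)` on `(−∞, 0)`,
`1/(−σ) + |∇ω(σ)(0)|²_F ≤ α(W(σ))(0)` (registered sub-goal `stub_apexStretchingSharp`): the full enstrophy-density identity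
`∂ₜ‖ω‖² + ∇‖ω‖²·u − Δ‖ω‖² = 2⟪ω, ∇u ω⟫ − 2|∇ω|²_F` (tree: `opL_norm_curl_sq_eq`) at the apex,
where `∂ₜ‖ω‖² = 2/(−σ)` (Danskin in time), `∇‖ω‖² = 0` and `Δ‖ω‖² ≤ 0` (spatial maximum). In
particular under a Type-I gauge bound `(−σ)‖∇W(σ)‖ ≤ K₀` the vorticity gradient at an apex obeys
`(−σ)|∇ω(σ)(0)|²_F ≤ K₀ − 1`. [cite: MajdaBertozziCUP2002, §5.1 (5.8)–(5.9)] -/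
theorem stub_apexStretchingSharp : ∀ (W : ℝ → EuclideanSpace ℝ (Fin 3) → EuclideanSpace ℝ (Fin 3)) (q : ℝ → EuclideanSpace ℝ (Fin 3) → ℝ) (σ : ℝ), IsClassicalNSSolutionOn (Iio 0) 1 0 W q → σ < 0 → ‖curl (W σ) 0‖ = 1 → (∀ s < 0, ∀ y : EuclideanSpace ℝ (Fin 3), (-s) * ‖curl (W s) y‖ ≤ -σ) → 1 / (-σ) + frobeniusNormSq (fderiv ℝ (curl (W σ)) 0) ≤ stretchingRate (W σ) 0 := by
  intro W q σ hWq hσ hω1 hapex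
  set G : ℝ := -σ with hG
  have hG0 : 0 < G := neg_pos.2 hσ
  -- Danskin in time
  set f : ℝ → ℝ := fun s => ‖curl (W s) 0‖ ^ 2 with hf
  have hcurl := isSmoothSpaceTimeOn_curl hWq.smooth_velocity isOpen_Iio
  have hfd : DifferentiableAt ℝ f σ :=
    ((hcurl.hasDerivAt_timeLine isOpen_Iio hσ 0).differentiableAt).norm_sq ℝ
  have hle : ∀ᶠ s in 𝓝 σ, f s ≤ σ ^ 2 / s ^ 2 := by
    filter_upwards [isOpen_Iio.mem_nhds hσ] with s hs
    have hs0 : 0 < -s := neg_pos.2 hs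
    have h1 : ‖curl (W s) 0‖ ≤ G / (-s) := by
      rw [le_div_iff₀ hs0, mul_comm]; exact hapex s hs 0
    have h2 : ‖curl (W s) 0‖ ^ 2 ≤ (G / (-s)) ^ 2 := pow_le_pow_left₀ (norm_nonneg _) h1 2
    calc f s = ‖curl (W s) 0‖ ^ 2 := rfl
      _ ≤ (G / (-s)) ^ 2 := h2
      _ = σ ^ 2 / s ^ 2 := by rw [hG, div_pow, neg_sq, neg_sq]
  have hf1 : f σ = 1 := by simp only [hf, hω1, one_pow]
  have hf' : deriv f σ = 2 / G := deriv_eq_of_le_sq_div_sq hσ hfd hle hf1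
  -- the time-translate onto the window `[0, G)`
  set t₀ : ℝ := σ - G / 2 with ht₀
  set u : ℝ → EuclideanSpace ℝ (Fin 3) → EuclideanSpace ℝ (Fin 3) :=
    (1 : ℝ) • stPull 1 1 t₀ 0 W with hu
  set qu : ℝ → EuclideanSpace ℝ (Fin 3) → ℝ := (1 : ℝ) ^ 2 • stPull 1 1 t₀ 0 q with hqu
  have hcl : IsClassicalNSSolutionOn (Ico 0 G) 1 0 u qu := by
    have key := hWq.stRescale one_pos one_pos (show (1 : ℝ) = 1 * 1 by norm_num) t₀ 0
    have hforce : ((1 : ℝ) ^ 2 * 1) • stPull 1 1 t₀ (0 : EuclideanSpace ℝ (Fin 3))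
        (0 : ℝ → EuclideanSpace ℝ (Fin 3) → EuclideanSpace ℝ (Fin 3)) = 0 := by
      funext s y; simp [stPull]
    rw [show (1 : ℝ) * 1 / 1 = 1 by norm_num, hforce] at key
    refine key.mono (fun r hr => ?_) (uniqueDiffOn_Ico 0 G)
    show t₀ + 1 * r ∈ Iio 0
    simp only [mem_Iio, ht₀, one_mul]
    linarith [hr.2]
  have hu_apply : ∀ s y, u s y = W (t₀ + s) y := by
    intro s y
    simp [hu]
  have huslice : ∀ s, u s = W (t₀ + s) := fun s => funext (hu_apply s)
  have hσeq : t₀ + G / 2 = σ := by simp only [ht₀]; ring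
  have huσ : u (G / 2) = W σ := by rw [huslice, hσeq]
  have hGI : G / 2 ∈ Ico 0 G := ⟨by linarith, by linarith⟩
  -- the spatial maximum at the apex: first- and second-order conditions
  have hmaxOn : IsMaxOn (fun y => ‖curl (W σ) y‖ ^ 2) univ 0 := by
    intro y _
    simp only [hω1, one_pow]
    have h1 : ‖curl (W σ) y‖ ≤ 1 := by
      have h := hapex σ hσ y
      rw [← hG] at h
      nlinarith
    exact (sq_le_one_iff₀ (norm_nonneg _)).2 h1
  have hW2 : ContDiff ℝ 2 (fun y => ‖curl (W σ) y‖ ^ 2) := by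
    have h := (contDiff_two_vorticity_of_classical hcl hGI).norm_sq ℝ
    simpa only [vorticity, huσ] using h
  have hloc : IsLocalMax (fun y => ‖curl (W σ) y‖ ^ 2) 0 := hmaxOn.isLocalMax univ_mem
  have hD : fderiv ℝ (fun y => ‖curl (W σ) y‖ ^ 2) 0 = 0 := hloc.fderiv_eq_zero
  have hΔ : (Laplacian.laplacian fun y => ‖curl (W σ) y‖ ^ 2) 0 ≤ 0 :=
    IsLocalMax.laplacian_nonpos hW2 hloc
  -- the enstrophy-density identity at the apex
  have hid := opL_norm_curl_sq_eq hcl (uniqueDiffOn_Ico 0 G) hGI 0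
  have hL : timeDerivWithin (Ico 0 G) (fun s y => ‖curl (u s) y‖ ^ 2) (G / 2) 0 = deriv f σ := by
    rw [timeDerivWithin, derivWithin_of_mem_nhds (Ico_mem_nhds (by linarith : (0 : ℝ) < G / 2) hGI.2)]
    have hfun : (fun s => ‖curl (u s) 0‖ ^ 2) = fun s => f (t₀ + s) := by
      funext s; simp only [hf, huslice]
    rw [hfun, deriv_comp_const_add, hσeq]
  rw [hL, hf', huσ, hD, zero_apply, ← norm_curl_sq_mul_stretchingRate, hω1,
    one_pow, one_mul, one_mul] at hid
  have key : 2 / G + 2 * frobeniusNormSq (fderiv ℝ (curl (W σ)) 0) ≤ 2 * stretchingRate (W σ) 0 := by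
    linarith
  have : 1 / G + frobeniusNormSq (fderiv ℝ (curl (W σ)) 0) ≤ stretchingRate (W σ) 0 := by
    have h2 : 2 / G = 2 * (1 / G) := by ring
    rw [h2] at key
    linarith
  simpa only [hG] using this

/-- **Second-order condition along any direction at an interior local maximum** of a `C²` function:
`D²W(x)[e, e] ≤ 0` (the line `s ↦ W(x + s e)`; cf. the tree's `IsLocalMax.laplacian_nonpos`, which
sums this over an orthonormal frame). [cite: Lieberman1996, Ch. II Lemma 2.1 (proof)] -/
theorem iteratedFDeriv_two_self_nonpos_of_isLocalMax {F : EuclideanSpace ℝ (Fin 3) → ℝ}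
    {x : EuclideanSpace ℝ (Fin 3)} (hF : ContDiff ℝ 2 F) (h : IsLocalMax F x)
    (e : EuclideanSpace ℝ (Fin 3)) : iteratedFDeriv ℝ 2 F x ![e, e] ≤ 0 := by
  set φ : ℝ → ℝ := fun s => F (x + s • e) with hφ
  have hFd : Differentiable ℝ F := hF.differentiable two_ne_zero
  have hφ1 : deriv φ = fun s => fderiv ℝ F (x + s • e) e :=
    funext fun s => (hasDerivAt_comp_line hFd x e s).deriv
  have hD1 : ContDiff ℝ 1 fun z => fderiv ℝ F z e :=
    (hF.fderiv_right (m := 1) le_rfl).clm_apply contDiff_const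
  have hφ2 : deriv (deriv φ) 0 = iteratedFDeriv ℝ 2 F x ![e, e] := by
    rw [hφ1, ← fderiv_fderiv_apply_const hF x e]
    have h2 := hasDerivAt_comp_line (hD1.differentiable one_ne_zero) x e 0
    rw [zero_smul, add_zero] at h2
    exact h2.deriv
  have hmax : IsLocalMax φ 0 := by
    have hc : Continuous fun s : ℝ => x + s • e := by fun_prop
    have ht : Tendsto (fun s : ℝ => x + s • e) (𝓝 0) (𝓝 x) := by
      simpa using hc.tendsto 0
    have h1 : ∀ᶠ s in 𝓝 (0 : ℝ), F (x + s • e) ≤ F x := ht.eventually h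
    show ∀ᶠ s in 𝓝 (0 : ℝ), φ s ≤ φ 0
    simpa [hφ] using h1
  have hcont : ContinuousAt φ 0 :=
    (hF.continuous.comp (by fun_prop : Continuous fun s : ℝ => x + s • e)).continuousAt
  rw [← hφ2]
  exact hmax.deriv_deriv_nonpos hcont

/-- **Registered sub-goal `stub_apexSpatial`: the spatial first- and second-order conditions at an
apex.** At an apex `(σ, 0)` of a classical pair on `(−∞, 0)`, `y ↦ ‖ω(σ, y)‖²` is globally maximal
at `0`, hence `∇‖ω(σ)‖²(0) = 0` and `D²‖ω(σ)‖²(0)[v, v] ≤ 0` for every direction `v` (in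
particular along the vorticity direction, the axis on which the blob inequality is read). [folklore] -/
theorem stub_apexSpatial : ∀ (W : ℝ → EuclideanSpace ℝ (Fin 3) → EuclideanSpace ℝ (Fin 3)) (q : ℝ → EuclideanSpace ℝ (Fin 3) → ℝ) (σ : ℝ), IsClassicalNSSolutionOn (Iio 0) 1 0 W q → σ < 0 → ‖curl (W σ) 0‖ = 1 → (∀ s < 0, ∀ y : EuclideanSpace ℝ (Fin 3), (-s) * ‖curl (W s) y‖ ≤ -σ) → fderiv ℝ (fun y => ‖curl (W σ) y‖ ^ 2) 0 = 0 ∧ ∀ v : EuclideanSpace ℝ (Fin 3), iteratedFDeriv ℝ 2 (fun y => ‖curl (W σ) y‖ ^ 2) 0 ![v, v] ≤ 0 := by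
  intro W q σ hWq hσ hω1 hapex
  set G : ℝ := -σ with hG
  have hG0 : 0 < G := neg_pos.2 hσ
  have hmaxOn : IsMaxOn (fun y => ‖curl (W σ) y‖ ^ 2) univ 0 := by
    intro y _
    simp only [hω1, one_pow]
    have h1 : ‖curl (W σ) y‖ ≤ 1 := by
      have h := hapex σ hσ y
      rw [← hG] at h
      nlinarith
    exact (sq_le_one_iff₀ (norm_nonneg _)).2 h1
  have hloc : IsLocalMax (fun y => ‖curl (W σ) y‖ ^ 2) 0 := hmaxOn.isLocalMax univ_mem
  have hW2 : ContDiff ℝ 2 (fun y => ‖curl (W σ) y‖ ^ 2) := by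
    have h := (contDiff_two_vorticity_of_classical hWq (show σ ∈ Iio 0 from hσ)).norm_sq ℝ
    simpa only [vorticity] using h
  exact ⟨hloc.fderiv_eq_zero, fun v => iteratedFDeriv_two_self_nonpos_of_isLocalMax hW2 hloc v⟩

end Summit.NavierStokesRegularity.NavierStokesRegularity.Theorems.BlobRiccatiClosure.TypeIApexLiouville

end
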